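import Summits.QuantumFields.BalabanUV.Beta.D1BFx.GhostWordJetMass
import Summits.QuantumFields.BalabanUV.Beta.D1BFx.RestJetEnvelopes
import Literature.MathematicalPhysics.QuantumFieldTheory.Balaban1983to89.Beta.LatticeConstantZl

/-!
# `BalabanUV.Beta.D1BFx.GhostWordJetLetters` — road «BF-x» for binder row D1, slot (K), DICT-CHAIN-SPEC §2 (II) row RK-GH, «RK-GH-UNIT» FILE 3b («RK-GH-JETS», road half):
# **THE CENTRED WEIGHTED ℓ¹-MASSES OF THE `ℋ`-PACKED GHOST JETS, n-EXPLICIT: first jets `n²•vertexRedF n ghCur μ y` have mass `≤ Cv·n`, the packed table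
# `n²•tableRedF n ([u = u′][κ = l]•gh₂) μ y ν y′` has mass `≤ Cw·n⁻⁴·e^{−(κ′∕8)|y′ − y|₁}`** (`n = m + 1`; the minimiser envelope `RestJetEnvelopes.abs_wH_fine_le` BY NAME)

HONEST DEPENDENCY (cell records, verbatim): «continuum YM on T⁴ ⇐ BetaPertH ∧ nine spine estimates (0/9 proved); BetaPertH ⇐ (D1) ∧ (D4) ∧
CAP+tail; G-an2-4 gates asym, D1 and NE2/3/4.»  HONEST FRAMING (cell contract, verbatim): «discharging `BetaPertH` makes Bałaban's UV stability
UNCONDITIONAL — a real constructive-QFT result; it is NOT the continuum limit and NOT the Clay problem.»  THIS MODULE DISCHARGES NOTHING of the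
wall: [folklore] `ℓ¹` bookkeeping over FILE 3a (`mass_wsum_le`, `mass_finset_sum_le`, `mass_smul_le`, `mass_ghCur_le`, `mass_gh₂_le`), leaf-01 g20's UNCONDITIONAL
minimiser envelope `RestJetEnvelopes.abs_wH_fine_le` (road FP's `abs_wH_le` in fine `ℓ¹` currency), the typer's `ReducedKernelF.vertexRedF` ∕ `ReducedTableF.tableRedF`
BY NAME, `ExpKernelCalculus.tsum_exp_shift'`∕`l1_natSmul` and `LatticeConstantZl.Zl_le_elem`.  No `def`, no `def … : Prop`, nothing cited, 0 sorry.  NO unit row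
(FILE 4); 0 root-level binders of row D1 discharged (hW ∕ hR-sockets ∕ hSX-socket ∕ D1Tel ∕ D1Rep — 0); (K) NOT closed; NOT D1, NOT `BetaPertH`, NOT continuum, NOT Clay.

ABSOLUTE RULE (cell charter, verbatim): «No internally-minted statement may enter as a cited fact. Every hypothesis is either kernel-proved in
this package or a verbatim quotation of a PUBLISHED theorem with page reference. The manuscript(s) under audit are NOT citable for their own
disputed steps — they are the thing under adjudication; programme-internal (2001/route/tribunal) claims are never citable.»

WHY (journal INTENT 1 «RK-GH-UNIT» [D1LEAF04-G18-ONLINE]; OWNER W-d1p2-g16-5 (B); leaf-01 W-d1leaf01-g20-3 (R2): the jets of record are the η-expanded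
families `fun κ u => (n²) • vertexRedF n (fun κ u => ghCur κ u) κ u` and `fun κ u l u′ => (n²) • tableRedF n (fun κ u l u′ => if u = u′ ∧ κ = l then gh₂ κ u else 0) κ u l u′`).
The count F-d1leaf04-g18-1 needs the first jets' mass `O(n)` (`n²·Σ'_u |wH(u)|·‖ghCur_u‖₁ = n²·O(n⁻⁵·n⁴)·2`) and the table's `O(n⁻⁴)·e^{−c|y′ − y|₁}` (`n²·Σ'_u |wH(u − ny)|·|wH(u − ny′)|·‖gh₂‖₁`).

CONTENT (all [folklore]; `n = m + 1`, `κ′ := kappa163 4 ∕ 4`, `C := (n⁵)⁻¹·(MG163 4·periodConst (kappa163 4) 3)·e^{κ′}` as in `RestJetEnvelopes`):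
* §1 the weights: `wH_const_nonneg`, **`tsum_abs_wH_mul_exp_le`** (`σ ≤ κ′∕(16n)` ⊢ `Σ'_u |wH κ l (u − n•y)|·e^{2σ|u − n•y|₁} ≤ C·Zl 4 (κ′∕(8n))`), **`tsum_abs_wH_mul_wH_le`** (`Σ'_u |wH κ μ (u − n•y)|·|wH κ ν (u − n•y′)| ≤ C·C·e^{−(κ′∕8)|y′ − y|₁}·Zl 4 (κ′∕(8n))`), `Zl_kappa_le` (`(n⁴)⁻¹·Zl 4 (κ′∕(8n)) ≤ (1 + 16∕κ′)⁴`).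
* §2 **`mass_vertexRedF_ghCur_le`**: for `0 ≤ σ ≤ κ′∕(16n)`, the centred weighted mass of `(n²)•vertexRedF n ghCur μ y` at `n•y`, rate `σ`, is summable and
  `≤ 8·e^{κ′∕16}·(MG163 4·periodConst (kappa163 4) 3)·e^{κ′}·(1 + 16∕κ′)⁴ · n`.
* §3 **`mass_tableRedF_gh11_le`** (via FILE 3a's `tableRedF_gh11_eq_sum`): the plain mass of
  `(n²)•tableRedF n ([u = u′][κ = l]•gh₂) μ y ν y′` is summable and `≤ 32·((MG163 4·periodConst (kappa163 4) 3)·e^{κ′})²·(1 + 16∕κ′)⁴ · (n⁴)⁻¹ · e^{−(κ′∕8)|y′ − y|₁}` (the sixteen colour pairs each bounded by the diagonal one).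
NOT HERE (honest): the legs (FILE 2), the rows (FILE 4).  Unit `b2b-balaban-beta-d1-formalise-leaf-04` (gen 18), road «BF-x»; INTENT 1 «RK-GH-UNIT» FILE 3b.
-/

noncomputable section
open Finset
open scoped BigOperators
open Literature.MathematicalPhysics.QuantumFieldTheory.Balaban1983to89
open Literature.MathematicalPhysics.QuantumFieldTheory.Balaban1983to89.Beta
open B12Sec2to5 (l1 l1_nonneg)
open B5Hk163Strip (kappa163 kappa163_pos)
open B5Hk163Decay (MG163)
open B4TorusKernel (periodConst)
open ExpKernelCalculus (Site MKer Zl Zl_pos Zl_nonneg tsum_exp_shift' summable_exp_shift' l1_sub_triangle l1_sub_symm l1_natSmul)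
open AffineAveraging (unitVec)
open KernelSpecInstance (wH)
open OneStepResolventKernel (wsum)
open LatticeConstantZl (Zl_le_elem Zl_anti)
open Summit.QuantumFields.BalabanUV.Beta.D1BFx.GhostStencil (ghCur l1_unitVec)
open Summit.QuantumFields.BalabanUV.Beta.D1BFx.TorusGhostPairStencils (gh₂)
open Summit.QuantumFields.BalabanUV.Beta.D1BFx.ReducedKernelF (vertexRedF vertexRedF_apply)
open Summit.QuantumFields.BalabanUV.Beta.D1BFx.ReducedTableF (tableRedF tableRedF_apply)
open Summit.QuantumFields.BalabanUV.Beta.D1BFx.RestJetEnvelopes (abs_wH_fine_le)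
open Summit.QuantumFields.BalabanUV.Beta.D1BFx.GhostWordJetMass (mass_wsum_le mass_finset_sum_le mass_smul_le mass_ghCur_le mass_gh₂_le vertexRedF_eq_sum
  wsum_diag_table tableRedF_gh11_eq_sum)

namespace Summit.QuantumFields.BalabanUV.Beta.D1BFx.GhostWordJetLetters
variable (m : ℕ)

/-! ## §1 The minimiser weights: one weight against a slow exponential, two weights against each other -/

/-- [folklore] The envelope's constant is nonnegative. -/
theorem wH_const_nonneg :
    0 ≤ ((((m + 1 : ℕ) : ℝ)) ^ (3 + 2))⁻¹ * (MG163 (3 + 1) * periodConst (kappa163 (3 + 1)) 3) * Real.exp (kappa163 (3 + 1) / (3 + 1)) := by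
  have h := abs_wH_fine_le m 0 0 0 0
  exact (mul_nonneg_iff_of_pos_right (Real.exp_pos _)).1 ((abs_nonneg _).trans h)

/-- [folklore] **ONE WEIGHT AGAINST A SLOW EXPONENTIAL**: for `σ ≤ κ′∕(16n)` (any sign),
`Σ'_u |wH κ l (u − n•y)|·e^{2σ|u − n•y|₁} ≤ C·Zl 4 (κ′∕(8n))` and the series is summable (`abs_wH_fine_le` leaves the rate `κ′∕(4n) − 2σ ≥ κ′∕(8n)`). -/
theorem tsum_abs_wH_mul_exp_le {σ : ℝ} (hσ : σ ≤ kappa163 (3 + 1) / (3 + 1) / (16 * ((m + 1 : ℕ) : ℝ))) (κ l : Fin 4) (y : Site 4) :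
    (Summable fun u : Site 4 => |wH (d := 3) (N := m + 1) κ l (u - ((m + 1 : ℕ) : ℤ) • y)| * Real.exp (2 * σ * l1 (u - ((m + 1 : ℕ) : ℤ) • y))) ∧
      ∑' u : Site 4, |wH (d := 3) (N := m + 1) κ l (u - ((m + 1 : ℕ) : ℤ) • y)| * Real.exp (2 * σ * l1 (u - ((m + 1 : ℕ) : ℤ) • y))
        ≤ ((((m + 1 : ℕ) : ℝ)) ^ (3 + 2))⁻¹ * (MG163 (3 + 1) * periodConst (kappa163 (3 + 1)) 3) * Real.exp (kappa163 (3 + 1) / (3 + 1))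
          * Zl 4 (kappa163 (3 + 1) / (3 + 1) / (8 * ((m + 1 : ℕ) : ℝ))) := by
  set C : ℝ := ((((m + 1 : ℕ) : ℝ)) ^ (3 + 2))⁻¹ * (MG163 (3 + 1) * periodConst (kappa163 (3 + 1)) 3) * Real.exp (kappa163 (3 + 1) / (3 + 1)) with hC
  have hC0 : 0 ≤ C := wH_const_nonneg m
  have hn : (0 : ℝ) < ((m + 1 : ℕ) : ℝ) := by exact_mod_cast Nat.succ_pos m
  have hκ := kappa163_pos (3 + 1)
  have hr : 0 < kappa163 (3 + 1) / (3 + 1) / (8 * ((m + 1 : ℕ) : ℝ)) := by positivity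
  set c : Site 4 := ((m + 1 : ℕ) : ℤ) • y with hc
  -- termwise majorant at the halved rate
  have hterm : ∀ u : Site 4, |wH (d := 3) (N := m + 1) κ l (u - c)| * Real.exp (2 * σ * l1 (u - c))
      ≤ C * Real.exp (-(kappa163 (3 + 1) / (3 + 1) / (8 * ((m + 1 : ℕ) : ℝ))) * l1 (u - c)) := by
    intro u
    have h1 := abs_wH_fine_le m κ l u y
    rw [← hc] at h1
    have hl := l1_nonneg (u - c)
    calc |wH (d := 3) (N := m + 1) κ l (u - c)| * Real.exp (2 * σ * l1 (u - c))
        ≤ (C * Real.exp (-(kappa163 (3 + 1) / (3 + 1) / (4 * ((m + 1 : ℕ) : ℝ))) * l1 (u - c))) * Real.exp (2 * σ * l1 (u - c)) :=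
          mul_le_mul_of_nonneg_right h1 (Real.exp_pos _).le
      _ = C * Real.exp (-(kappa163 (3 + 1) / (3 + 1) / (4 * ((m + 1 : ℕ) : ℝ))) * l1 (u - c) + 2 * σ * l1 (u - c)) := by
          rw [Real.exp_add]; ring
      _ ≤ C * Real.exp (-(kappa163 (3 + 1) / (3 + 1) / (8 * ((m + 1 : ℕ) : ℝ))) * l1 (u - c)) := by
          refine mul_le_mul_of_nonneg_left (Real.exp_le_exp.2 ?_) hC0
          have e8 : kappa163 (3 + 1) / (3 + 1) / (4 * ((m + 1 : ℕ) : ℝ)) = 2 * (kappa163 (3 + 1) / (3 + 1) / (8 * ((m + 1 : ℕ) : ℝ))) := by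
            field_simp; ring
          have e16 : kappa163 (3 + 1) / (3 + 1) / (16 * ((m + 1 : ℕ) : ℝ)) = (kappa163 (3 + 1) / (3 + 1) / (8 * ((m + 1 : ℕ) : ℝ))) / 2 := by
            field_simp; ring
          rw [e16] at hσ
          rw [e8]
          nlinarith [hl, hr]
  have hs := (summable_exp_shift' hr c).mul_left C
  have hnn : ∀ u : Site 4, 0 ≤ |wH (d := 3) (N := m + 1) κ l (u - c)| * Real.exp (2 * σ * l1 (u - c)) := fun u => by positivity
  have hsum := Summable.of_nonneg_of_le hnn hterm hs
  refine ⟨hsum, (hsum.tsum_le_tsum hterm hs).trans (le_of_eq ?_)⟩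
  rw [tsum_mul_left, tsum_exp_shift']

/-- [folklore] **TWO WEIGHTS AGAINST EACH OTHER** (the table's weight): `Σ'_u |wH κ μ (u − n•y)|·|wH κ ν (u − n•y′)| ≤ C·C·e^{−(κ′∕8)|y′ − y|₁}·Zl 4 (κ′∕(8n))`
and the series is summable (half the rate pays the `u`-sum, the other half reaches the COARSE separation through `|n•y′ − n•y|₁ = n·|y′ − y|₁`). -/
theorem tsum_abs_wH_mul_wH_le (κ μ ν : Fin 4) (y y' : Site 4) :
    (Summable fun u : Site 4 =>
      |wH (d := 3) (N := m + 1) κ μ (u - ((m + 1 : ℕ) : ℤ) • y)| * |wH (d := 3) (N := m + 1) κ ν (u - ((m + 1 : ℕ) : ℤ) • y')|) ∧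
      ∑' u : Site 4, |wH (d := 3) (N := m + 1) κ μ (u - ((m + 1 : ℕ) : ℤ) • y)| * |wH (d := 3) (N := m + 1) κ ν (u - ((m + 1 : ℕ) : ℤ) • y')|
        ≤ (((((m + 1 : ℕ) : ℝ)) ^ (3 + 2))⁻¹ * (MG163 (3 + 1) * periodConst (kappa163 (3 + 1)) 3) * Real.exp (kappa163 (3 + 1) / (3 + 1)))
          * (((((m + 1 : ℕ) : ℝ)) ^ (3 + 2))⁻¹ * (MG163 (3 + 1) * periodConst (kappa163 (3 + 1)) 3) * Real.exp (kappa163 (3 + 1) / (3 + 1)))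
          * Real.exp (-(kappa163 (3 + 1) / (3 + 1) / 8) * l1 (y' - y)) * Zl 4 (kappa163 (3 + 1) / (3 + 1) / (8 * ((m + 1 : ℕ) : ℝ))) := by
  set C : ℝ := ((((m + 1 : ℕ) : ℝ)) ^ (3 + 2))⁻¹ * (MG163 (3 + 1) * periodConst (kappa163 (3 + 1)) 3) * Real.exp (kappa163 (3 + 1) / (3 + 1)) with hC
  have hC0 : 0 ≤ C := wH_const_nonneg m
  have hn : (0 : ℝ) < ((m + 1 : ℕ) : ℝ) := by exact_mod_cast Nat.succ_pos m
  have hκ := kappa163_pos (3 + 1)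
  set r : ℝ := kappa163 (3 + 1) / (3 + 1) / (8 * ((m + 1 : ℕ) : ℝ)) with hr
  have hr0 : 0 < r := by positivity
  set c : Site 4 := ((m + 1 : ℕ) : ℤ) • y with hc
  set c' : Site 4 := ((m + 1 : ℕ) : ℤ) • y' with hc'
  -- the coarse exponential: `r·|c′ − c|₁ = (κ′∕8)·|y′ − y|₁`
  have hcc : r * l1 (c' - c) = kappa163 (3 + 1) / (3 + 1) / 8 * l1 (y' - y) := by
    rw [hc, hc', ← smul_sub, l1_natSmul, hr]
    field_simp
  -- termwise majorant
  have hterm : ∀ u : Site 4, |wH (d := 3) (N := m + 1) κ μ (u - c)| * |wH (d := 3) (N := m + 1) κ ν (u - c')|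
      ≤ C * C * Real.exp (-(kappa163 (3 + 1) / (3 + 1) / 8) * l1 (y' - y)) * Real.exp (-r * l1 (u - c)) := by
    intro u
    have h1 := abs_wH_fine_le m κ μ u y
    have h2 := abs_wH_fine_le m κ ν u y'
    rw [← hc] at h1
    rw [← hc'] at h2
    have e4 : kappa163 (3 + 1) / (3 + 1) / (4 * ((m + 1 : ℕ) : ℝ)) = 2 * r := by rw [hr]; field_simp; ring
    rw [e4] at h1 h2
    have t : l1 (c' - c) ≤ l1 (c' - u) + l1 (u - c) := l1_sub_triangle c' u c
    rw [l1_sub_symm c' u] at t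
    have hu := l1_nonneg (u - c)
    have hu' := l1_nonneg (u - c')
    calc |wH (d := 3) (N := m + 1) κ μ (u - c)| * |wH (d := 3) (N := m + 1) κ ν (u - c')|
        ≤ (C * Real.exp (-(2 * r) * l1 (u - c))) * (C * Real.exp (-(2 * r) * l1 (u - c'))) :=
          mul_le_mul h1 h2 (abs_nonneg _) ((abs_nonneg _).trans h1)
      _ = C * C * Real.exp (-(2 * r) * l1 (u - c) + -(2 * r) * l1 (u - c')) := by rw [Real.exp_add]; ring
      _ ≤ C * C * Real.exp (-r * l1 (c' - c) + -r * l1 (u - c)) := by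
          refine mul_le_mul_of_nonneg_left (Real.exp_le_exp.2 ?_) (mul_nonneg hC0 hC0)
          nlinarith [mul_nonneg hr0.le hu, mul_nonneg hr0.le hu', mul_nonneg hr0.le (show 0 ≤ l1 (u - c') + l1 (u - c) - l1 (c' - c) by linarith)]
      _ = C * C * Real.exp (-(kappa163 (3 + 1) / (3 + 1) / 8) * l1 (y' - y)) * Real.exp (-r * l1 (u - c)) := by
          rw [Real.exp_add, show -r * l1 (c' - c) = -(r * l1 (c' - c)) by ring, hcc]; ring
  have hs := (summable_exp_shift' hr0 c).mul_left (C * C * Real.exp (-(kappa163 (3 + 1) / (3 + 1) / 8) * l1 (y' - y)))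
  have hnn : ∀ u : Site 4, 0 ≤ |wH (d := 3) (N := m + 1) κ μ (u - c)| * |wH (d := 3) (N := m + 1) κ ν (u - c')| := fun u => by positivity
  have hsum := Summable.of_nonneg_of_le hnn hterm hs
  refine ⟨hsum, (hsum.tsum_le_tsum hterm hs).trans (le_of_eq ?_)⟩
  rw [tsum_mul_left, tsum_exp_shift']

/-- [folklore] **THE VOLUME FACTOR AGAINST FOUR POWERS OF `n`**: `(n⁴)⁻¹·Zl 4 (κ′∕(8n)) ≤ (1 + 16∕κ′)⁴` (`Zl_le_elem`: `Zl 4 c ≤ (1 + 2∕c)⁴`, `2∕c = 16n∕κ′`). -/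
theorem Zl_kappa_le :
    ((((m + 1 : ℕ) : ℝ)) ^ 4)⁻¹ * Zl 4 (kappa163 (3 + 1) / (3 + 1) / (8 * ((m + 1 : ℕ) : ℝ))) ≤ (1 + 16 / (kappa163 (3 + 1) / (3 + 1))) ^ 4 := by
  have hn : (1 : ℝ) ≤ ((m + 1 : ℕ) : ℝ) := by exact_mod_cast Nat.le_add_left 1 m
  have hn0 : (0 : ℝ) < ((m + 1 : ℕ) : ℝ) := by positivity
  have hκ : 0 < kappa163 (3 + 1) / (3 + 1) := by have := kappa163_pos (3 + 1); positivity
  have hc : 0 < kappa163 (3 + 1) / (3 + 1) / (8 * ((m + 1 : ℕ) : ℝ)) := by positivity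
  have h1 := Zl_le_elem hc 4
  have e : 1 + 2 / (kappa163 (3 + 1) / (3 + 1) / (8 * ((m + 1 : ℕ) : ℝ))) = 1 + 16 * ((m + 1 : ℕ) : ℝ) / (kappa163 (3 + 1) / (3 + 1)) := by
    field_simp; ring
  rw [e] at h1
  have h2 : 1 + 16 * ((m + 1 : ℕ) : ℝ) / (kappa163 (3 + 1) / (3 + 1)) ≤ ((m + 1 : ℕ) : ℝ) * (1 + 16 / (kappa163 (3 + 1) / (3 + 1))) := by
    have e2 : ((m + 1 : ℕ) : ℝ) * (1 + 16 / (kappa163 (3 + 1) / (3 + 1))) = ((m + 1 : ℕ) : ℝ) + 16 * ((m + 1 : ℕ) : ℝ) / (kappa163 (3 + 1) / (3 + 1)) := by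
      ring
    rw [e2]; linarith
  have h3 := pow_le_pow_left₀ (by positivity) h2 4
  rw [mul_pow] at h3
  rw [inv_mul_le_iff₀ (pow_pos hn0 4)]
  exact h1.trans h3

/-! ## §2 The packed first jet `n²•vertexRedF n ghCur μ y`: centred weighted mass `≤ Cv·n` -/

/-- [folklore] **THE FIRST JET'S MASS**: for `0 ≤ σ ≤ κ′∕(16n)`, the centred weighted ℓ¹-mass of `(n²)•vertexRedF n ghCur μ y` at `n•y`, rate `σ`, is summable
and `≤ 8·e^{κ′∕16}·(MG163 4·periodConst (kappa163 4) 3)·e^{κ′}·(1 + 16∕κ′)⁴ · n` — `n² × (n⁵)⁻¹ × Zl 4 (κ′∕(8n)) ≤ n²·n⁻⁵·n⁴·(1 + 16∕κ′)⁴`. -/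
theorem mass_vertexRedF_ghCur_le {σ : ℝ} (hσ0 : 0 ≤ σ) (hσ : σ ≤ kappa163 (3 + 1) / (3 + 1) / (16 * ((m + 1 : ℕ) : ℝ))) (μ : Fin 4) (y : Site 4) :
    (Summable fun p : Site 4 × Site 4 => ∑ a, ∑ b,
        |((((m + 1 : ℕ) : ℝ) ^ 2) • vertexRedF (m + 1) (fun κ u => ghCur κ u) μ y) p.1 p.2 a b|
          * Real.exp (σ * (l1 (p.1 - ((m + 1 : ℕ) : ℤ) • y) + l1 (p.2 - ((m + 1 : ℕ) : ℤ) • y)))) ∧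
      ∑' p : Site 4 × Site 4, ∑ a, ∑ b,
        |((((m + 1 : ℕ) : ℝ) ^ 2) • vertexRedF (m + 1) (fun κ u => ghCur κ u) μ y) p.1 p.2 a b|
          * Real.exp (σ * (l1 (p.1 - ((m + 1 : ℕ) : ℤ) • y) + l1 (p.2 - ((m + 1 : ℕ) : ℤ) • y)))
        ≤ 8 * Real.exp (kappa163 (3 + 1) / (3 + 1) / 16) * (MG163 (3 + 1) * periodConst (kappa163 (3 + 1)) 3) * Real.exp (kappa163 (3 + 1) / (3 + 1))
          * (1 + 16 / (kappa163 (3 + 1) / (3 + 1))) ^ 4 * ((m + 1 : ℕ) : ℝ) := by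
  set n : ℕ := m + 1 with hn
  set C : ℝ := ((((m + 1 : ℕ) : ℝ)) ^ (3 + 2))⁻¹ * (MG163 (3 + 1) * periodConst (kappa163 (3 + 1)) 3) * Real.exp (kappa163 (3 + 1) / (3 + 1)) with hC
  have hC0 : 0 ≤ C := wH_const_nonneg m
  have hn0 : (0 : ℝ) < ((m + 1 : ℕ) : ℝ) := by exact_mod_cast Nat.succ_pos m
  have hκ : 0 < kappa163 (3 + 1) / (3 + 1) := by have := kappa163_pos (3 + 1); positivity
  set c : Site 4 := ((m + 1 : ℕ) : ℤ) • y with hc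
  set W : Site 4 × Site 4 → ℝ := fun p => Real.exp (σ * (l1 (p.1 - c) + l1 (p.2 - c))) with hW
  have hWpos : ∀ p, 0 < W p := fun p => Real.exp_pos _
  -- the stencils' masses against `W`: two unit entries, each within one step of `u`
  have hρ : ∀ (κ' : Fin 4) (u : Site 4), W (u + unitVec κ', u) + W (u, u + unitVec κ') ≤ 2 * Real.exp σ * Real.exp (2 * σ * l1 (u - c)) := by
    intro κ' u
    have t : l1 (u + unitVec κ' - c) ≤ l1 (u - c) + 1 := by
      have h := l1_sub_triangle (u + unitVec κ') u c
      rw [add_sub_cancel_left, l1_unitVec] at h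
      linarith
    have hu := l1_nonneg (u - c)
    have h1 : W (u + unitVec κ', u) ≤ Real.exp σ * Real.exp (2 * σ * l1 (u - c)) := by
      simp only [hW]
      rw [← Real.exp_add]
      exact Real.exp_le_exp.2 (by nlinarith [mul_nonneg hσ0 (show 0 ≤ l1 (u - c) + 1 - l1 (u + unitVec κ' - c) by linarith)])
    have h2 : W (u, u + unitVec κ') ≤ Real.exp σ * Real.exp (2 * σ * l1 (u - c)) := by
      simp only [hW]
      rw [← Real.exp_add]
      exact Real.exp_le_exp.2 (by nlinarith [mul_nonneg hσ0 (show 0 ≤ l1 (u - c) + 1 - l1 (u + unitVec κ' - c) by linarith)])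
    linarith
  -- per colour: the superposition's mass
  have hcol : ∀ κ' : Fin 4,
      (Summable fun p : Site 4 × Site 4 => ∑ a, ∑ b,
          |wsum (fun u => wH (d := 3) (N := m + 1) κ' μ (u - c)) (fun u => ghCur κ' u) p.1 p.2 a b| * W p) ∧
        ∑' p : Site 4 × Site 4, ∑ a, ∑ b, |wsum (fun u => wH (d := 3) (N := m + 1) κ' μ (u - c)) (fun u => ghCur κ' u) p.1 p.2 a b| * W p
          ≤ 2 * Real.exp σ * (C * Zl 4 (kappa163 (3 + 1) / (3 + 1) / (8 * ((m + 1 : ℕ) : ℝ)))) := by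
    intro κ'
    obtain ⟨hws, hwb⟩ := tsum_abs_wH_mul_exp_le m hσ κ' μ y
    rw [← hc] at hws hwb
    have hρs : Summable fun u : Site 4 => |wH (d := 3) (N := m + 1) κ' μ (u - c)| * (W (u + unitVec κ', u) + W (u, u + unitVec κ')) :=
      Summable.of_nonneg_of_le (fun u => mul_nonneg (abs_nonneg _) (add_nonneg (hWpos _).le (hWpos _).le))
        (fun u => by
          calc |wH (d := 3) (N := m + 1) κ' μ (u - c)| * (W (u + unitVec κ', u) + W (u, u + unitVec κ'))
              ≤ |wH (d := 3) (N := m + 1) κ' μ (u - c)| * (2 * Real.exp σ * Real.exp (2 * σ * l1 (u - c))) :=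
                mul_le_mul_of_nonneg_left (hρ κ' u) (abs_nonneg _)
            _ = 2 * Real.exp σ * (|wH (d := 3) (N := m + 1) κ' μ (u - c)| * Real.exp (2 * σ * l1 (u - c))) := by ring)
        (hws.mul_left (2 * Real.exp σ))
    have h := mass_wsum_le (w := fun u => wH (d := 3) (N := m + 1) κ' μ (u - c)) (K := fun u => ghCur κ' u) hWpos
      (fun u => (mass_ghCur_le (fun p => (hWpos p).le) κ' u).1) (fun u => (mass_ghCur_le (fun p => (hWpos p).le) κ' u).2) hρs
    refine ⟨h.1, h.2.trans ?_⟩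
    calc ∑' u : Site 4, |wH (d := 3) (N := m + 1) κ' μ (u - c)| * (W (u + unitVec κ', u) + W (u, u + unitVec κ'))
        ≤ ∑' u : Site 4, 2 * Real.exp σ * (|wH (d := 3) (N := m + 1) κ' μ (u - c)| * Real.exp (2 * σ * l1 (u - c))) :=
          hρs.tsum_le_tsum (fun u => by
            calc |wH (d := 3) (N := m + 1) κ' μ (u - c)| * (W (u + unitVec κ', u) + W (u, u + unitVec κ'))
                ≤ |wH (d := 3) (N := m + 1) κ' μ (u - c)| * (2 * Real.exp σ * Real.exp (2 * σ * l1 (u - c))) :=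
                  mul_le_mul_of_nonneg_left (hρ κ' u) (abs_nonneg _)
              _ = 2 * Real.exp σ * (|wH (d := 3) (N := m + 1) κ' μ (u - c)| * Real.exp (2 * σ * l1 (u - c))) := by ring)
            (hws.mul_left (2 * Real.exp σ))
      _ = 2 * Real.exp σ * ∑' u : Site 4, |wH (d := 3) (N := m + 1) κ' μ (u - c)| * Real.exp (2 * σ * l1 (u - c)) := tsum_mul_left
      _ ≤ 2 * Real.exp σ * (C * Zl 4 (kappa163 (3 + 1) / (3 + 1) / (8 * ((m + 1 : ℕ) : ℝ)))) := mul_le_mul_of_nonneg_left hwb (by positivity)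
  -- the colour sum and the factor `n²`
  have hsum := mass_finset_sum_le (Finset.univ : Finset (Fin 4)) (fun p => (hWpos p).le) (fun κ' _ => (hcol κ').1) (fun κ' _ => (hcol κ').2)
  rw [← vertexRedF_eq_sum (m + 1) (fun κ u => ghCur κ u) μ y] at hsum
  have hsm := mass_smul_le (c := ((m + 1 : ℕ) : ℝ) ^ 2) hsum.1 hsum.2
  refine ⟨hsm.1, hsm.2.trans ?_⟩
  -- the count: `n² · 4 · (2e^{σ}·C·Zl) ≤ 8 e^{κ′∕16} C₄ e^{κ′} (1+16∕κ′)⁴ · n`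
  rw [Finset.sum_const, Finset.card_univ, Fintype.card_fin, nsmul_eq_mul, abs_of_nonneg (by positivity)]
  have hσ16 : Real.exp σ ≤ Real.exp (kappa163 (3 + 1) / (3 + 1) / 16) := by
    apply Real.exp_le_exp.2
    refine hσ.trans ?_
    rw [div_le_div_iff_of_pos_left hκ (by positivity) (by norm_num)]
    have : (1 : ℝ) ≤ ((m + 1 : ℕ) : ℝ) := by exact_mod_cast Nat.le_add_left 1 m
    linarith
  have hZ := Zl_kappa_le m
  have hZ0 : 0 ≤ Zl 4 (kappa163 (3 + 1) / (3 + 1) / (8 * ((m + 1 : ℕ) : ℝ))) := Zl_nonneg (by positivity)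
  -- `C = (n⁵)⁻¹·C₄·e^{κ′}`; rearrange `n²·(n⁵)⁻¹·Zl = n·((n⁴)⁻¹·Zl)·… `
  have e : ((m + 1 : ℕ) : ℝ) ^ 2 * ((4 : ℕ) * (2 * Real.exp σ * (C * Zl 4 (kappa163 (3 + 1) / (3 + 1) / (8 * ((m + 1 : ℕ) : ℝ))))))
      = 8 * Real.exp σ * (MG163 (3 + 1) * periodConst (kappa163 (3 + 1)) 3) * Real.exp (kappa163 (3 + 1) / (3 + 1))
        * (((((m + 1 : ℕ) : ℝ)) ^ 4)⁻¹ * Zl 4 (kappa163 (3 + 1) / (3 + 1) / (8 * ((m + 1 : ℕ) : ℝ)))) * ((m + 1 : ℕ) : ℝ) := by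
    rw [hC]; push_cast; field_simp; ring
  rw [e]
  have hK : 0 ≤ (MG163 (3 + 1) * periodConst (kappa163 (3 + 1)) 3) * Real.exp (kappa163 (3 + 1) / (3 + 1)) := by
    have h := wH_const_nonneg m
    have hn5 : 0 < ((((m + 1 : ℕ) : ℝ)) ^ (3 + 2))⁻¹ := by positivity
    rw [mul_assoc] at h
    exact (mul_nonneg_iff_of_pos_left hn5).1 h
  have h8 : 0 ≤ 8 * Real.exp σ * (MG163 (3 + 1) * periodConst (kappa163 (3 + 1)) 3) * Real.exp (kappa163 (3 + 1) / (3 + 1)) := by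
    have h' := mul_nonneg (show (0 : ℝ) ≤ 8 * Real.exp σ by positivity) hK
    calc (0 : ℝ) ≤ _ := h'
      _ = _ := by ring
  calc 8 * Real.exp σ * (MG163 (3 + 1) * periodConst (kappa163 (3 + 1)) 3) * Real.exp (kappa163 (3 + 1) / (3 + 1))
        * (((((m + 1 : ℕ) : ℝ)) ^ 4)⁻¹ * Zl 4 (kappa163 (3 + 1) / (3 + 1) / (8 * ((m + 1 : ℕ) : ℝ)))) * ((m + 1 : ℕ) : ℝ)
      ≤ 8 * Real.exp σ * (MG163 (3 + 1) * periodConst (kappa163 (3 + 1)) 3) * Real.exp (kappa163 (3 + 1) / (3 + 1))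
        * (1 + 16 / (kappa163 (3 + 1) / (3 + 1))) ^ 4 * ((m + 1 : ℕ) : ℝ) :=
        mul_le_mul_of_nonneg_right (mul_le_mul_of_nonneg_left hZ h8) hn0.le
    _ ≤ 8 * Real.exp (kappa163 (3 + 1) / (3 + 1) / 16) * (MG163 (3 + 1) * periodConst (kappa163 (3 + 1)) 3) * Real.exp (kappa163 (3 + 1) / (3 + 1))
        * (1 + 16 / (kappa163 (3 + 1) / (3 + 1))) ^ 4 * ((m + 1 : ℕ) : ℝ) := by
        have hrest : 0 ≤ (MG163 (3 + 1) * periodConst (kappa163 (3 + 1)) 3) * Real.exp (kappa163 (3 + 1) / (3 + 1))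
            * (1 + 16 / (kappa163 (3 + 1) / (3 + 1))) ^ 4 * ((m + 1 : ℕ) : ℝ) := by positivity
        calc 8 * Real.exp σ * (MG163 (3 + 1) * periodConst (kappa163 (3 + 1)) 3) * Real.exp (kappa163 (3 + 1) / (3 + 1))
              * (1 + 16 / (kappa163 (3 + 1) / (3 + 1))) ^ 4 * ((m + 1 : ℕ) : ℝ)
            = (8 * Real.exp σ) * ((MG163 (3 + 1) * periodConst (kappa163 (3 + 1)) 3) * Real.exp (kappa163 (3 + 1) / (3 + 1))
              * (1 + 16 / (kappa163 (3 + 1) / (3 + 1))) ^ 4 * ((m + 1 : ℕ) : ℝ)) := by ring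
          _ ≤ (8 * Real.exp (kappa163 (3 + 1) / (3 + 1) / 16)) * ((MG163 (3 + 1) * periodConst (kappa163 (3 + 1)) 3) * Real.exp (kappa163 (3 + 1) / (3 + 1))
              * (1 + 16 / (kappa163 (3 + 1) / (3 + 1))) ^ 4 * ((m + 1 : ℕ) : ℝ)) :=
              mul_le_mul_of_nonneg_right (by linarith) hrest
          _ = _ := by ring

/-! ## §3 The packed ghost table `n²•tableRedF n ([u = u′][κ = l]•gh₂) μ y ν y′`: plain mass `≤ Cw·n⁻⁴·e^{−(κ′∕8)|y′ − y|₁}` -/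

/-- [folklore] **THE PACKED TABLE'S MASS**: the plain (unweighted) ℓ¹-mass of `(n²)•tableRedF n ([u = u′][κ = l]•gh₂) μ y ν y′` is summable and
`≤ 32·((MG163 4·periodConst (kappa163 4) 3)·e^{κ′})²·(1 + 16∕κ′)⁴·(n⁴)⁻¹·e^{−(κ′∕8)|y′ − y|₁}` — `n² × (n⁵)⁻² × Zl 4 (κ′∕(8n)) = n⁻⁴·((n⁴)⁻¹·Zl)`, the sixteen
colour pairs each bounded by the diagonal one (`‖gh₂‖₁ = 2`). -/
theorem mass_tableRedF_gh11_le (μ : Fin 4) (y : Site 4) (ν : Fin 4) (y' : Site 4) :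
    (Summable fun p : Site 4 × Site 4 => ∑ a, ∑ b,
        |((((m + 1 : ℕ) : ℝ) ^ 2) • tableRedF (m + 1) (fun κ u l u' => if u = u' ∧ κ = l then gh₂ κ u else 0) μ y ν y') p.1 p.2 a b| * (1 : ℝ)) ∧
      ∑' p : Site 4 × Site 4, ∑ a, ∑ b,
        |((((m + 1 : ℕ) : ℝ) ^ 2) • tableRedF (m + 1) (fun κ u l u' => if u = u' ∧ κ = l then gh₂ κ u else 0) μ y ν y') p.1 p.2 a b| * (1 : ℝ)
        ≤ 32 * ((MG163 (3 + 1) * periodConst (kappa163 (3 + 1)) 3) * Real.exp (kappa163 (3 + 1) / (3 + 1))) ^ 2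
          * (1 + 16 / (kappa163 (3 + 1) / (3 + 1))) ^ 4 * ((((m + 1 : ℕ) : ℝ)) ^ 4)⁻¹
          * Real.exp (-(kappa163 (3 + 1) / (3 + 1) / 8) * l1 (y' - y)) := by
  set C : ℝ := ((((m + 1 : ℕ) : ℝ)) ^ (3 + 2))⁻¹ * (MG163 (3 + 1) * periodConst (kappa163 (3 + 1)) 3) * Real.exp (kappa163 (3 + 1) / (3 + 1)) with hC
  have hC0 : 0 ≤ C := wH_const_nonneg m
  have hn0 : (0 : ℝ) < ((m + 1 : ℕ) : ℝ) := by exact_mod_cast Nat.succ_pos m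
  have hκ : 0 < kappa163 (3 + 1) / (3 + 1) := by have := kappa163_pos (3 + 1); positivity
  set E : ℝ := Real.exp (-(kappa163 (3 + 1) / (3 + 1) / 8) * l1 (y' - y)) with hE
  set Z : ℝ := Zl 4 (kappa163 (3 + 1) / (3 + 1) / (8 * ((m + 1 : ℕ) : ℝ))) with hZ
  have hZ0 : 0 ≤ Z := Zl_nonneg (by positivity)
  have hWpos : ∀ p : Site 4 × Site 4, (0 : ℝ) < (fun _ => (1 : ℝ)) p := fun _ => one_pos
  -- per colour pair: ONE superposition of `gh₂ κ′ u` with product weights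
  have hpair : ∀ κ' l' : Fin 4,
      (Summable fun p : Site 4 × Site 4 => ∑ a, ∑ b,
          |wsum (fun u => wH (N := m + 1) (d := 3) κ' μ (u - ((m + 1 : ℕ) : ℤ) • y)
              * (if κ' = l' then wH (N := m + 1) (d := 3) l' ν (u - ((m + 1 : ℕ) : ℤ) • y') else 0)) (fun u => gh₂ κ' u) p.1 p.2 a b| * (1 : ℝ)) ∧
        ∑' p : Site 4 × Site 4, ∑ a, ∑ b,
          |wsum (fun u => wH (N := m + 1) (d := 3) κ' μ (u - ((m + 1 : ℕ) : ℤ) • y)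
              * (if κ' = l' then wH (N := m + 1) (d := 3) l' ν (u - ((m + 1 : ℕ) : ℤ) • y') else 0)) (fun u => gh₂ κ' u) p.1 p.2 a b| * (1 : ℝ)
          ≤ 2 * (C * C * E * Z) := by
    intro κ' l'
    -- the stencil masses against `W = 1`: `≤ 1 + 1`
    have hρ := fun u => mass_gh₂_le (W := fun _ : Site 4 × Site 4 => (1 : ℝ)) (fun _ => zero_le_one) κ' u
    by_cases hκl : κ' = l'
    · subst hκl
      obtain ⟨hws, hwb⟩ := tsum_abs_wH_mul_wH_le m κ' μ ν y y'
      have hws2 : Summable fun u : Site 4 => |wH (N := m + 1) (d := 3) κ' μ (u - ((m + 1 : ℕ) : ℤ) • y)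
          * (if κ' = κ' then wH (N := m + 1) (d := 3) κ' ν (u - ((m + 1 : ℕ) : ℤ) • y') else 0)| * ((1 : ℝ) + 1) := by
        refine (hws.mul_right ((1 : ℝ) + 1)).congr fun u => ?_
        rw [if_pos rfl, abs_mul]
      have h := mass_wsum_le (K := fun u => gh₂ κ' u) hWpos (fun u => (hρ u).1) (fun u => (hρ u).2) hws2
      refine ⟨h.1, h.2.trans ?_⟩
      have e : ∑' u : Site 4, |wH (N := m + 1) (d := 3) κ' μ (u - ((m + 1 : ℕ) : ℤ) • y)
          * (if κ' = κ' then wH (N := m + 1) (d := 3) κ' ν (u - ((m + 1 : ℕ) : ℤ) • y') else 0)| * ((1 : ℝ) + 1)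
          = 2 * ∑' u : Site 4, |wH (N := m + 1) (d := 3) κ' μ (u - ((m + 1 : ℕ) : ℤ) • y)| * |wH (N := m + 1) (d := 3) κ' ν (u - ((m + 1 : ℕ) : ℤ) • y')| := by
        rw [← tsum_mul_left]
        exact tsum_congr fun u => by rw [if_pos rfl, abs_mul]; ring
      rw [e]
      exact mul_le_mul_of_nonneg_left (by simpa only [hC, hE, hZ] using hwb) zero_le_two
    · have hw0 : (fun u : Site 4 => |wH (N := m + 1) (d := 3) κ' μ (u - ((m + 1 : ℕ) : ℤ) • y)
          * (if κ' = l' then wH (N := m + 1) (d := 3) l' ν (u - ((m + 1 : ℕ) : ℤ) • y') else 0)| * ((1 : ℝ) + 1)) = fun _ => 0 := by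
        funext u; rw [if_neg hκl, mul_zero, abs_zero, zero_mul]
      have hws2 : Summable fun u : Site 4 => |wH (N := m + 1) (d := 3) κ' μ (u - ((m + 1 : ℕ) : ℤ) • y)
          * (if κ' = l' then wH (N := m + 1) (d := 3) l' ν (u - ((m + 1 : ℕ) : ℤ) • y') else 0)| * ((1 : ℝ) + 1) := by
        rw [hw0]; exact summable_zero
      have h := mass_wsum_le (K := fun u => gh₂ κ' u) hWpos (fun u => (hρ u).1) (fun u => (hρ u).2) hws2
      refine ⟨h.1, h.2.trans ?_⟩
      rw [hw0, tsum_zero]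
      positivity
  -- the sixteen pairs and the factor `n²`
  have hinner : ∀ κ' : Fin 4,
      (Summable fun p : Site 4 × Site 4 => ∑ a, ∑ b,
          |(∑ l' : Fin 4, wsum (fun u => wH (N := m + 1) (d := 3) κ' μ (u - ((m + 1 : ℕ) : ℤ) • y)
              * (if κ' = l' then wH (N := m + 1) (d := 3) l' ν (u - ((m + 1 : ℕ) : ℤ) • y') else 0)) (fun u => gh₂ κ' u)) p.1 p.2 a b| * (1 : ℝ)) ∧
        ∑' p : Site 4 × Site 4, ∑ a, ∑ b,
          |(∑ l' : Fin 4, wsum (fun u => wH (N := m + 1) (d := 3) κ' μ (u - ((m + 1 : ℕ) : ℤ) • y)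
              * (if κ' = l' then wH (N := m + 1) (d := 3) l' ν (u - ((m + 1 : ℕ) : ℤ) • y') else 0)) (fun u => gh₂ κ' u)) p.1 p.2 a b| * (1 : ℝ)
          ≤ ∑ _l' : Fin 4, 2 * (C * C * E * Z) := fun κ' =>
    mass_finset_sum_le (Finset.univ : Finset (Fin 4)) (fun _ => zero_le_one) (fun l' _ => (hpair κ' l').1) (fun l' _ => (hpair κ' l').2)
  have hsum := mass_finset_sum_le (Finset.univ : Finset (Fin 4)) (fun _ => zero_le_one) (fun κ' _ => (hinner κ').1) (fun κ' _ => (hinner κ').2)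
  rw [← tableRedF_gh11_eq_sum (m + 1) μ y ν y'] at hsum
  have hsm := mass_smul_le (c := ((m + 1 : ℕ) : ℝ) ^ 2) hsum.1 hsum.2
  refine ⟨hsm.1, hsm.2.trans ?_⟩
  rw [Finset.sum_const, Finset.card_univ, Fintype.card_fin, Finset.sum_const, Finset.card_univ, Fintype.card_fin, nsmul_eq_mul, nsmul_eq_mul,
    abs_of_nonneg (by positivity)]
  have hZ4 := Zl_kappa_le m
  have e : ((m + 1 : ℕ) : ℝ) ^ 2 * ((4 : ℕ) * ((4 : ℕ) * (2 * (C * C * E * Z))))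
      = 32 * ((MG163 (3 + 1) * periodConst (kappa163 (3 + 1)) 3) * Real.exp (kappa163 (3 + 1) / (3 + 1))) ^ 2
        * (((((m + 1 : ℕ) : ℝ)) ^ 4)⁻¹ * Z) * ((((m + 1 : ℕ) : ℝ)) ^ 4)⁻¹ * E := by
    rw [hC]; push_cast; field_simp; ring
  rw [e]
  have hK : 0 ≤ 32 * ((MG163 (3 + 1) * periodConst (kappa163 (3 + 1)) 3) * Real.exp (kappa163 (3 + 1) / (3 + 1))) ^ 2 := by positivity
  have hrest : 0 ≤ ((((m + 1 : ℕ) : ℝ)) ^ 4)⁻¹ * E := by positivity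
  calc 32 * ((MG163 (3 + 1) * periodConst (kappa163 (3 + 1)) 3) * Real.exp (kappa163 (3 + 1) / (3 + 1))) ^ 2
        * (((((m + 1 : ℕ) : ℝ)) ^ 4)⁻¹ * Z) * ((((m + 1 : ℕ) : ℝ)) ^ 4)⁻¹ * E
      = (32 * ((MG163 (3 + 1) * periodConst (kappa163 (3 + 1)) 3) * Real.exp (kappa163 (3 + 1) / (3 + 1))) ^ 2
        * (((((m + 1 : ℕ) : ℝ)) ^ 4)⁻¹ * Z)) * (((((m + 1 : ℕ) : ℝ)) ^ 4)⁻¹ * E) := by ring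
    _ ≤ (32 * ((MG163 (3 + 1) * periodConst (kappa163 (3 + 1)) 3) * Real.exp (kappa163 (3 + 1) / (3 + 1))) ^ 2
        * (1 + 16 / (kappa163 (3 + 1) / (3 + 1))) ^ 4) * (((((m + 1 : ℕ) : ℝ)) ^ 4)⁻¹ * E) :=
        mul_le_mul_of_nonneg_right (mul_le_mul_of_nonneg_left hZ4 hK) hrest
    _ = _ := by ring

/-- [folklore] … the same letter with the trivial weight erased (the shape of `GhostWordFamilies.decay510_tadpoleWord_of_mass`). -/
theorem mass_tableRedF_gh11_le' (μ : Fin 4) (y : Site 4) (ν : Fin 4) (y' : Site 4) :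
    (Summable fun p : Site 4 × Site 4 => ∑ a, ∑ b,
        |((((m + 1 : ℕ) : ℝ) ^ 2) • tableRedF (m + 1) (fun κ u l u' => if u = u' ∧ κ = l then gh₂ κ u else 0) μ y ν y') p.1 p.2 a b|) ∧
      ∑' p : Site 4 × Site 4, ∑ a, ∑ b,
        |((((m + 1 : ℕ) : ℝ) ^ 2) • tableRedF (m + 1) (fun κ u l u' => if u = u' ∧ κ = l then gh₂ κ u else 0) μ y ν y') p.1 p.2 a b|
        ≤ 32 * ((MG163 (3 + 1) * periodConst (kappa163 (3 + 1)) 3) * Real.exp (kappa163 (3 + 1) / (3 + 1))) ^ 2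
          * (1 + 16 / (kappa163 (3 + 1) / (3 + 1))) ^ 4 * ((((m + 1 : ℕ) : ℝ)) ^ 4)⁻¹
          * Real.exp (-(kappa163 (3 + 1) / (3 + 1) / 8) * l1 (y' - y)) := by
  simpa only [mul_one] using mass_tableRedF_gh11_le m μ y ν y'

end Summit.QuantumFields.BalabanUV.Beta.D1BFx.GhostWordJetLetters

end
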